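import Summits.Ventures.PercRepro.GenQTraceProfileD

/-!
# PercRepro — the trace profiles, part E: the cap (T8) as an LP row (night-4, gen 11)

The pairs `(H, F)` — `H` a rank-`(q − 1)` flat with a spanning trace, `F ⊆ H` a rank-`r` flat with a spanning trace of
`s′` points — number at most `C(n − s′, q − 1 − r)·NR^sp_{r, s′}` (`inside_pairs_le`): counting by `F` and applying
`card_hypSp_through_le` to each.  This is the row (T8) of the two-level profile LP, the cap on the aggregate
`NL / NP / NS` of the flats inside the traces (sheet §65 (b) (T)).  Imports `GenQTraceProfileD`.
-/
namespace PercRepro.Night4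

open Finset ThmH SixFour GenQ PerFlat Star

variable {α : Type*} [DecidableEq α] {M : Matroid α} [M.Finite]

/-- `NRin_{s, r, s′}`: the rank-`r` flats with spanning `s′`-point traces INSIDE the `s`-point spanning traces of
rank `q − 1`, summed over those traces. -/
noncomputable def nrInM (M : Matroid α) [M.Finite] (G : Finset α) (q s r s' : ℕ) : ℕ :=
  ∑ H ∈ flatsTr M G (q - 1) s, ((flatsTr M G r s').filter (fun F : Finset α => F ⊆ H)).card

/-- **(T8)** the flats inside the traces, counted by the flat: `Σ_s NRin_{s, r, s′} ≤ C(n − s′, q − 1 − r)·h^{(r)}_{s′}`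
(`h^{(r)}_{s′} = hypTr M G r s′`, the rank-`r` flats with spanning `s′`-point traces). -/
theorem sum_nrInM_le {G : Finset α} (hG : G ⊆ gr M) (q r s' : ℕ) :
    ∑ s ∈ Finset.range (G.card + 1), nrInM M G q s r s' ≤ (G.card - s').choose (q - 1 - r) * hypTr M G r s' := by
  classical
  unfold nrInM
  -- swap: Σ_s Σ_{H ∈ flatsTr (q−1) s} #{F ∈ flatsTr r s′ : F ⊆ H} = Σ_{F ∈ flatsTr r s′} #{H : F ⊆ H}
  have hswap : ∑ s ∈ Finset.range (G.card + 1), ∑ H ∈ flatsTr M G (q - 1) s,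
        ((flatsTr M G r s').filter (fun F : Finset α => F ⊆ H)).card
      = ∑ F ∈ flatsTr M G r s', ∑ s ∈ Finset.range (G.card + 1),
          ((flatsTr M G (q - 1) s).filter (fun H : Finset α => F ⊆ H)).card := by
    simp only [Finset.card_eq_sum_ones, Finset.sum_filter]
    have h1 : ∀ s, ∑ H ∈ flatsTr M G (q - 1) s, ∑ F ∈ flatsTr M G r s', (if F ⊆ H then 1 else 0)
        = ∑ F ∈ flatsTr M G r s', ∑ H ∈ flatsTr M G (q - 1) s, (if F ⊆ H then 1 else 0) :=
      fun s => Finset.sum_comm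
    simp_rw [h1]
    exact Finset.sum_comm
  rw [hswap]
  unfold hypTr
  rw [Finset.card_eq_sum_ones (flatsTr M G r s'), Finset.mul_sum, mul_one]
  refine Finset.sum_le_sum (fun F hF => ?_)
  have hF' := mem_flatsTr.1 hF
  -- the traces of all sizes through `F` are `hypSpThrough`
  have hcover : ∑ s ∈ Finset.range (G.card + 1), ((flatsTr M G (q - 1) s).filter (fun H : Finset α => F ⊆ H)).card
      = (hypSpThrough M G F q).card := by
    unfold hypSpThrough flatsTr
    rw [← Finset.card_biUnion]
    · congr 1
      ext H
      simp only [Finset.mem_biUnion, Finset.mem_range, Finset.mem_filter]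
      constructor
      · rintro ⟨s, _, ⟨⟨hH, _, hsp⟩, hFH⟩⟩
        exact ⟨hH, hsp, hFH⟩
      · rintro ⟨hH, hsp, hFH⟩
        exact ⟨(H ∩ G).card, Nat.lt_succ_of_le (Finset.card_le_card Finset.inter_subset_right), ⟨⟨hH, rfl, hsp⟩, hFH⟩⟩
    · intro s _ t _ hst
      rw [Function.onFun, Finset.disjoint_left]
      intro H h1 h2
      rw [Finset.mem_filter, Finset.mem_filter] at h1 h2
      exact hst (h1.1.2.1.symm.trans h2.1.2.1)
  rw [hcover]
  exact card_hypSp_through_le hG hF'.2.1 hF'.2.2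

end PercRepro.Night4
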